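import Summits.CriticalPhenomena.Ising3D.IsingColumnFaceL11CensusRadiiJointCore

/-!
# The catalogue census of §7.3 as kernel facts, XIV-C: kernel evaluations for the JOINT radius of `LIN ∪ TRG` —
window `2` of the merged covering check, part `2` of the `LIN` hole-window check, parts `4`, `5` of the `TRG`
hole-window check (cell `pub-ising3x`, seat recog-1; paper §1.6 / §7.3)

HONEST FRAMING: lottery ticket; floor = tightest certified 3D Ising CFT bounds; no exact-solution claim without a
proof. Island framing: certified exclusion region at stated derivative order and assumptions; not a determination of
the 3D Ising critical exponents beyond that.

Four `decide +kernel` evaluations of the machine of `IsingColumnFaceL11CensusRadiiJointCore.lean` (see its header):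
* `jointCover_p2` — window `2` of `4` of the certified segment in units `linU = 10¹⁸·27720`: the kernel enumerates the
  `LIN` candidates of the window (landed `linWin`; `30649` of them, by the twin), sorts their certified enclosures
  (`msortN`), merges the `44` witness enclosures `jointWit2.map witEnc` (`mergeN`) after checking the witnesses' side
  conditions, and checks the chain with gap constant `jointG` (`zgapsLE`);
* `jointHoleL_part2` — part `2` (`linExcludedPart`, `ExclusionSentencesLin`) of the landed exhaustive `LIN` checker on the
  hole window `[jointHoleA, jointHoleB]` listing the single tuple `jointHoleY`;
* `jointHoleT_part4`, `jointHoleT_part5` — parts `4`, `5` (`trgFullPart`, `ExclusionSentencesTrgGamma`) of the landed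
  exhaustive `TRG` checker on the same window listing the single tuple `jointHoleX`.
Assembled in `…CensusRadiiJoint.lean`. Every Bool was `#eval`-ed `true` before filing (recog-1 gen 57 `EvalAll.lean`).
The heartbeat / recursion options are those of parts VII/VIII (long evaluations, not deep ones). Pure arithmetic;
no certificate, no datum, no σ–ε axiom; nothing is recognised.
lottery ticket; floor = tightest certified 3D Ising CFT bounds; no exact-solution claim without a proof.
-/

namespace Summit.CriticalPhenomena.Ising3D
namespace ColumnFaceL11
open Set Literature.MathematicalPhysics.QuantumFieldTheory.ConformalBootstrap3D

set_option maxHeartbeats 200000000 in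
set_option maxRecDepth 200000 in
/-- JOINT window `2`: start `36862998046874999999999`, end `37752934570312499999999 + jointG` (units `linU`): the witnesses of
`jointWit2` satisfy `trgGTupleOK 17 32`, and along the merged sorted list every enclosure's upper end is within `jointG`
of the running reference point, up to the end. [folklore] -/
theorem jointCover_p2 :
    jointCover jointG 36862998046874999999999 (37752934570312499999999 + jointG) jointWit2 = true := by
  decide +kernel

set_option maxHeartbeats 200000000 in
set_option maxRecDepth 200000 in
/-- Part `2` of the landed `LIN` checker on the hole window lists only `jointHoleY`. [folklore] -/
theorem jointHoleL_part2 : linExcludedPart 12 2 jointHoleA jointHoleB [jointHoleY] = true := by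
  decide +kernel

set_option maxHeartbeats 200000000 in
set_option maxRecDepth 200000 in
/-- Part `4` of the landed `TRG` checker on the hole window lists only `jointHoleX`. [folklore] -/
theorem jointHoleT_part4 : trgFullPart 17 32 4 jointHoleA jointHoleB [jointHoleX] = true := by
  decide +kernel

set_option maxHeartbeats 200000000 in
set_option maxRecDepth 200000 in
/-- Part `5` of the landed `TRG` checker on the hole window lists only `jointHoleX`. [folklore] -/
theorem jointHoleT_part5 : trgFullPart 17 32 5 jointHoleA jointHoleB [jointHoleX] = true := by
  decide +kernel

end ColumnFaceL11
end Summit.CriticalPhenomena.Ising3D
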